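import Summits.AtomisticToContinuum.HydrodynamicLimit.Theorems.InformationPercolationEngineChaosClosesEulerPressureValueD
import Summits.AtomisticToContinuum.HydrodynamicLimit.Theorems.InformationPercolationEngineChaosClosesEulerPressureValueB
import Summits.AtomisticToContinuum.HydrodynamicLimit.Theorems.LocalSecondLaw.Negative.EquilibriumL1
import HarnessLib

/-!
# Collisional pressure value in band (crux `ChaosClosesEuler`, stmt-AtomisticToContinuum-15141, line `Sketch`,
# stub `stub_pressureValueOfEnskog`) — helper E: bounded measurable space–time fields (Fubini toolkit)

WHAT. The Enskog side of the windowed collision statistics and every error term of the value identification are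
iterated integrals `∫_{s ∈ [lo, hi]} ∫_{𝕋³} F(s, x) dx ds` of BOUNDED, jointly MEASURABLE space–time fields (cone fields
read along a good orbit). This file is the measure-theoretic glue, stated once for an abstract field
`F : ℝ → 𝕋³ → ℝ` with `Measurable (uncurry F)` and `|F| ≤ C`:

* slices are integrable, the space integral is measurable and bounded in time, hence integrable on windows
  (`integrable_slice`, `measurable_integral_slice`, `integrableOn_integral_slice`), with the bounds
  `|∫∫ F| ≤ (hi − lo) C`, additivity and monotonicity of the iterated integral;
* **the window transpose** (`integral_integral_mul_window_eq`): testing the tent × cone WINDOWED field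
  `R(t₀, x₀) = σ³ ∫_{s} bt(s − t₀) ∫_x b_r(x, x₀) F(s, x)` against a continuous `a(t₀, x₀)` gives
  `σ³ ∫_s ∫_x ã(s, x) F(s, x)` with the smoothed coefficient `ã` of helper C (Fubini on `([lo,hi] × 𝕋³) × ([0,τ] × 𝕋³)`,
  the integrand being bounded and jointly measurable);
* measurability and the bound of the windowed field `R` itself (`measurable_windowField`, `abs_windowField_le`).

References: elementary measure theory (Fubini–Tonelli for bounded measurable integrands on finite product measures).
-/

noncomputable section

namespace Summit.AtomisticToContinuum.HydrodynamicLimit.Theorems.ChaosClosesEulerPressureValue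

open scoped BigOperators Topology Classical MeasureTheory ENNReal InnerProductSpace
open Filter Set MeasureTheory
open Literature.MathematicalPhysics.KineticTheory
open Literature.Analysis.FluidPDE
open Summit.AtomisticToContinuum.HydrodynamicLimit.Theorems.LocalSecondLawNegative
open Summit.AtomisticToContinuum.HydrodynamicLimit.Theorems.LocalSecondLawLedger
open Summit.AtomisticToContinuum.HydrodynamicLimit.Theorems.LocalSecondLawLedger.L
  (Mmom rhoC_eq_sum momC_apply_eq_sum momC_eq_sum kinC_eq_trace norm_sq_eq_sum)

/-- The truncated stress mark `𝒯[L,k,l]` (local notation for an explicit lambda). -/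
local notation3 "𝒯[" L ", " k ", " l "]" => fun q : V3 × V3 × V3 =>
  min |⟪q.2.1 - q.2.2, q.1⟫_ℝ| (4 * L) * (speedCutoff L ‖q.2.1‖ * speedCutoff L ‖q.2.2‖) * (clip1 (q.1 k) * clip1 (q.1 l))

/-- The dominating mark `ℬ[L]` (local notation for an explicit lambda). -/
local notation3 "ℬ[" L "]" => fun q : V3 × V3 × V3 => 4 * L * (speedCutoff L ‖q.2.1‖ * speedCutoff L ‖q.2.2‖)

section Toolkit

open Function

variable {F G : ℝ → T3 → ℝ} {C D : ℝ}

/-- A slice of a bounded jointly measurable field is integrable over the torus. [folklore] -/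
theorem integrable_slice (hF : Measurable (uncurry F)) (hFb : ∀ s x, |F s x| ≤ C) (s : ℝ) :
    Integrable (F s) (volume : Measure T3) :=
  Integrable.of_bound (hF.comp (measurable_const.prodMk measurable_id)).aestronglyMeasurable C
    (ae_of_all _ fun x => by rw [Real.norm_eq_abs]; exact hFb s x)

/-- The space integral of a bounded jointly measurable field is measurable in time. [folklore] -/
theorem measurable_integral_slice (hF : Measurable (uncurry F)) : Measurable fun s => ∫ x, F s x :=
  (hF.stronglyMeasurable.integral_prod_right (ν := (volume : Measure T3))).measurable

/-- The space integral of a bounded field is bounded by the bound (the torus has unit volume). [folklore] -/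
theorem abs_integral_slice_le (hFb : ∀ s x, |F s x| ≤ C) (s : ℝ) : |∫ x, F s x| ≤ C := by
  have h := norm_integral_le_of_norm_le_const (μ := (volume : Measure T3)) (f := F s) (C := C)
    (ae_of_all _ fun x => by rw [Real.norm_eq_abs]; exact hFb s x)
  rwa [Real.norm_eq_abs, probReal_univ, mul_one] at h

/-- The space integral of a bounded jointly measurable field is integrable on every bounded time window. [folklore] -/
theorem integrableOn_integral_slice (hF : Measurable (uncurry F)) (hFb : ∀ s x, |F s x| ≤ C) (lo hi : ℝ) :
    IntegrableOn (fun s => ∫ x, F s x) (Icc lo hi) volume := by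
  haveI : IsFiniteMeasure ((volume : Measure ℝ).restrict (Icc lo hi)) :=
    ⟨by rw [Measure.restrict_apply_univ, Real.volume_Icc]; exact ENNReal.ofReal_lt_top⟩
  exact Integrable.of_bound (measurable_integral_slice hF).aestronglyMeasurable C
    (ae_of_all _ fun s => by rw [Real.norm_eq_abs]; exact abs_integral_slice_le hFb s)

/-- `|∫_{s ∈ [lo,hi]} ∫_x F| ≤ (hi − lo) C` for `lo ≤ hi`. [folklore] -/
theorem abs_setIntegral_integral_le (hFb : ∀ s x, |F s x| ≤ C) {lo hi : ℝ} (hle : lo ≤ hi) :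
    |∫ s in Icc lo hi, ∫ x, F s x| ≤ (hi - lo) * C := by
  have h := norm_setIntegral_le_of_norm_le_const (μ := (volume : Measure ℝ)) (s := Icc lo hi)
    (f := fun s => ∫ x, F s x) (C := C) (by rw [Real.volume_Icc]; exact ENNReal.ofReal_lt_top)
    (fun s _ => by rw [Real.norm_eq_abs]; exact abs_integral_slice_le hFb s)
  rwa [Real.norm_eq_abs, Measure.real, Real.volume_Icc, ENNReal.toReal_ofReal (by linarith), mul_comm] at h

/-- Additivity of the iterated integral for bounded jointly measurable fields. [folklore] -/
theorem setIntegral_integral_add (hF : Measurable (uncurry F)) (hFb : ∀ s x, |F s x| ≤ C)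
    (hG : Measurable (uncurry G)) (hGb : ∀ s x, |G s x| ≤ D) (lo hi : ℝ) :
    ∫ s in Icc lo hi, ∫ x, (F s x + G s x) = (∫ s in Icc lo hi, ∫ x, F s x) + ∫ s in Icc lo hi, ∫ x, G s x := by
  rw [← integral_add (integrableOn_integral_slice hF hFb lo hi) (integrableOn_integral_slice hG hGb lo hi)]
  exact integral_congr_ae (ae_of_all _ fun s => integral_add (integrable_slice hF hFb s) (integrable_slice hG hGb s))

/-- The iterated integral of a difference of bounded jointly measurable fields. [folklore] -/
theorem setIntegral_integral_sub (hF : Measurable (uncurry F)) (hFb : ∀ s x, |F s x| ≤ C)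
    (hG : Measurable (uncurry G)) (hGb : ∀ s x, |G s x| ≤ D) (lo hi : ℝ) :
    ∫ s in Icc lo hi, ∫ x, (F s x - G s x) = (∫ s in Icc lo hi, ∫ x, F s x) - ∫ s in Icc lo hi, ∫ x, G s x := by
  rw [← integral_sub (integrableOn_integral_slice hF hFb lo hi) (integrableOn_integral_slice hG hGb lo hi)]
  exact integral_congr_ae (ae_of_all _ fun s => integral_sub (integrable_slice hF hFb s) (integrable_slice hG hGb s))

/-- Scalars come out of the iterated integral. [folklore] -/
theorem setIntegral_integral_const_mul (c : ℝ) (F : ℝ → T3 → ℝ) (lo hi : ℝ) :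
    ∫ s in Icc lo hi, ∫ x, c * F s x = c * ∫ s in Icc lo hi, ∫ x, F s x := by
  rw [← integral_const_mul]
  exact integral_congr_ae (ae_of_all _ fun s => integral_const_mul c _)

/-- **Domination of the iterated integral**: `|F| ≤ G` pointwise on `[lo, hi] × 𝕋³` for a bounded jointly measurable
`G` gives `|∫∫ F| ≤ ∫∫ G` (no hypothesis on `F`: the junk value `0` of a non-integrable slice obeys the bound).
[folklore] -/
theorem abs_setIntegral_integral_le_of_le (hG : Measurable (uncurry G)) (hGb : ∀ s x, |G s x| ≤ D) {lo hi : ℝ}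
    (hFG : ∀ s ∈ Icc lo hi, ∀ x, |F s x| ≤ G s x) :
    |∫ s in Icc lo hi, ∫ x, F s x| ≤ ∫ s in Icc lo hi, ∫ x, G s x := by
  have hslice : ∀ s ∈ Icc lo hi, |∫ x, F s x| ≤ ∫ x, G s x := by
    intro s hs
    calc |∫ x, F s x| ≤ ∫ x, |F s x| := abs_integral_le_integral_abs
      _ ≤ ∫ x, G s x := by
          by_cases hI : Integrable (fun x => |F s x|) volume
          · exact integral_mono hI (integrable_slice hG hGb s) fun x => hFG s hs x
          · rw [integral_undef hI]
            exact integral_nonneg fun x => (abs_nonneg _).trans (hFG s hs x)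
  calc |∫ s in Icc lo hi, ∫ x, F s x| ≤ ∫ s in Icc lo hi, |∫ x, F s x| := abs_integral_le_integral_abs
    _ ≤ ∫ s in Icc lo hi, ∫ x, G s x := by
        by_cases hI : IntegrableOn (fun s => |∫ x, F s x|) (Icc lo hi) volume
        · exact setIntegral_mono_on hI (integrableOn_integral_slice hG hGb lo hi) measurableSet_Icc hslice
        · rw [integral_undef hI]
          exact setIntegral_nonneg measurableSet_Icc fun s hs => (abs_nonneg _).trans (hslice s hs)

/-- Monotonicity of the iterated integral in the time window for a nonnegative bounded measurable field. [folklore] -/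
theorem setIntegral_integral_mono_set (hG : Measurable (uncurry G)) (hGb : ∀ s x, |G s x| ≤ D)
    (hG0 : ∀ s x, 0 ≤ G s x) {lo hi lo' hi' : ℝ} (h : Icc lo hi ⊆ Icc lo' hi') :
    ∫ s in Icc lo hi, ∫ x, G s x ≤ ∫ s in Icc lo' hi', ∫ x, G s x :=
  setIntegral_mono_set (integrableOn_integral_slice hG hGb lo' hi')
    (ae_of_all _ fun s => integral_nonneg fun x => hG0 s x) (ae_of_all _ h)

end Toolkit

/-! ## §2 The window transpose -/

section Window

open Function

/-- The tent × cone window kernel tested against `a`, `(t₀, x₀, s, x) ↦ a(t₀, x₀) bt(s − t₀) b_r(x, x₀) F(s, x)`, is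
jointly measurable. [folklore] -/
theorem measurable_windowKernel {a : ℝ × T3 → ℝ} (ha : Continuous a) (r : ℝ) {F : ℝ → T3 → ℝ}
    (hF : Measurable (uncurry F)) :
    Measurable fun v : (ℝ × T3) × (ℝ × T3) =>
      a v.1 * (r⁻¹ * max (1 - |v.2.1 - v.1.1| / r) 0 * cone r v.2.2 v.1.2) * F v.2.1 v.2.2 := by
  have h1 : Measurable fun v : (ℝ × T3) × (ℝ × T3) => a v.1 := ha.measurable.comp measurable_fst
  have h2 : Measurable fun v : (ℝ × T3) × (ℝ × T3) => r⁻¹ * max (1 - |v.2.1 - v.1.1| / r) 0 :=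
    measurable_const.mul ((measurable_const.sub ((measurable_snd.fst.sub measurable_fst.fst).abs.div_const r)).max
      measurable_const)
  -- the cone is composed at the scalar level (`measurable_coneKernel_comp`), not through a `T3 × T3`-valued map
  have h3 : Measurable fun v : (ℝ × T3) × (ℝ × T3) => cone r v.2.2 v.1.2 := by
    simp only [← coneKernel_eq_cone]
    exact measurable_coneKernel_comp r measurable_snd.snd measurable_fst.snd
  have h4 : Measurable fun v : (ℝ × T3) × (ℝ × T3) => F v.2.1 v.2.2 := hF.comp measurable_snd
  exact (h1.mul (h2.mul h3)).mul h4

/-- **The window transpose.** For a bounded jointly measurable field `F` and a continuous coefficient `a`,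
`∫_{t₀ ∈ [lo,hi]} ∫_{x₀} a(t₀,x₀) · σ³ ∫_{s ∈ [0,τ]} bt(s − t₀) ∫_x b_r(x, x₀) F(s, x)
 = σ³ ∫_{s ∈ [0,τ]} ∫_x (∫_{t₀ ∈ [lo,hi]} ∫_{x₀} a(t₀,x₀) bt(s − t₀) b_r(x, x₀)) F(s, x)` (`0 < r`). [folklore] -/
theorem integral_integral_mul_window_eq {a : ℝ × T3 → ℝ} (ha : Continuous a) {A : ℝ} (hA : ∀ p, |a p| ≤ A)
    {r : ℝ} (hr : 0 < r) {F : ℝ → T3 → ℝ} (hF : Measurable (uncurry F)) {C : ℝ} (hFb : ∀ s x, |F s x| ≤ C)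
    (σ lo hi τ : ℝ) :
    ∫ t₀ in Icc lo hi, ∫ x₀, a (t₀, x₀) *
        (σ ^ 3 * ∫ s in Icc 0 τ, r⁻¹ * max (1 - |s - t₀| / r) 0 * ∫ x, cone r x x₀ * F s x) =
      σ ^ 3 * ∫ s in Icc 0 τ, ∫ x,
        (∫ t₀ in Icc lo hi, ∫ x₀, a (t₀, x₀) * (r⁻¹ * max (1 - |s - t₀| / r) 0 * cone r x x₀)) * F s x := by
  -- the kernel and its bound
  set K : (ℝ × T3) × (ℝ × T3) → ℝ := fun v =>
    a v.1 * (r⁻¹ * max (1 - |v.2.1 - v.1.1| / r) 0 * cone r v.2.2 v.1.2) * F v.2.1 v.2.2 with hKdef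
  have hKm : Measurable K := measurable_windowKernel ha r hF
  have hA0 : 0 ≤ A := (abs_nonneg _).trans (hA (0, 0))
  have hC0 : 0 ≤ C := (abs_nonneg _).trans (hFb 0 0)
  set B : ℝ := A * (r⁻¹ * (3 / (Real.pi * r ^ 3))) * C with hBdef
  have hKb : ∀ v, ‖K v‖ ≤ B := by
    intro v
    rw [Real.norm_eq_abs, hKdef]
    dsimp only
    have ht := ChaosClosesEulerWindowedInvariance.tent_nonneg_le hr (v.2.1 - v.1.1)
    have hc0 := cone_nonneg hr v.2.2 v.1.2
    have hc1 : cone r v.2.2 v.1.2 ≤ 3 / (Real.pi * r ^ 3) :=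
      (le_abs_self _).trans (LocalSecondLawLedger.L.abs_cone_le hr v.2.2 v.1.2)
    rw [abs_mul, abs_mul, abs_mul, abs_of_nonneg ht.1, abs_of_nonneg hc0]
    have h1 : |a v.1| * (r⁻¹ * max (1 - |v.2.1 - v.1.1| / r) 0 * cone r v.2.2 v.1.2) ≤
        A * (r⁻¹ * (3 / (Real.pi * r ^ 3))) :=
      mul_le_mul (hA _) (mul_le_mul ht.2 hc1 hc0 (inv_nonneg.2 hr.le)) (mul_nonneg ht.1 hc0) hA0
    exact mul_le_mul h1 (hFb _ _) (abs_nonneg _) (by positivity)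
  -- the two finite product measures
  set μ₁ : Measure (ℝ × T3) := (volume.restrict (Icc lo hi)).prod volume with hμ₁
  set μ₂ : Measure (ℝ × T3) := (volume.restrict (Icc 0 τ)).prod volume with hμ₂
  haveI : IsFiniteMeasure ((volume : Measure ℝ).restrict (Icc lo hi)) :=
    ⟨by rw [Measure.restrict_apply_univ, Real.volume_Icc]; exact ENNReal.ofReal_lt_top⟩
  haveI : IsFiniteMeasure ((volume : Measure ℝ).restrict (Icc 0 τ)) :=
    ⟨by rw [Measure.restrict_apply_univ, Real.volume_Icc]; exact ENNReal.ofReal_lt_top⟩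
  haveI : IsFiniteMeasure μ₁ := by rw [hμ₁]; infer_instance
  haveI : IsFiniteMeasure μ₂ := by rw [hμ₂]; infer_instance
  have hInt : Integrable (uncurry fun p q => K (p, q)) (μ₁.prod μ₂) :=
    Integrable.of_bound (hKm.comp measurable_id).aestronglyMeasurable B (ae_of_all _ fun v => hKb v)
  have hIntp : ∀ p, Integrable (fun q => K (p, q)) μ₂ := fun p =>
    Integrable.of_bound (hKm.comp (measurable_const.prodMk measurable_id)).aestronglyMeasurable B
      (ae_of_all _ fun q => hKb _)
  have hIntq : ∀ q, Integrable (fun p => K (p, q)) μ₁ := fun q =>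
    Integrable.of_bound (hKm.comp (measurable_id.prodMk measurable_const)).aestronglyMeasurable B
      (ae_of_all _ fun p => hKb _)
  -- LHS as `σ³ ∫_p ∫_q K`
  have hL : ∀ t₀ x₀, a (t₀, x₀) * (σ ^ 3 * ∫ s in Icc 0 τ, r⁻¹ * max (1 - |s - t₀| / r) 0 * ∫ x, cone r x x₀ * F s x) =
      σ ^ 3 * ∫ q, K ((t₀, x₀), q) ∂μ₂ := by
    intro t₀ x₀
    rw [hμ₂, integral_prod _ (hIntp (t₀, x₀)), mul_left_comm, ← integral_const_mul]
    congr 1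
    refine integral_congr_ae (ae_of_all _ fun s => ?_)
    dsimp only
    rw [← integral_const_mul, ← integral_const_mul]
    refine integral_congr_ae (ae_of_all _ fun x => ?_)
    rw [hKdef]
    ring
  have hR : ∀ s x, (∫ t₀ in Icc lo hi, ∫ x₀, a (t₀, x₀) * (r⁻¹ * max (1 - |s - t₀| / r) 0 * cone r x x₀)) * F s x =
      ∫ p, K (p, (s, x)) ∂μ₁ := by
    intro s x
    rw [hμ₁, integral_prod _ (hIntq (s, x)), ← integral_mul_const]
    refine integral_congr_ae (ae_of_all _ fun t₀ => ?_)
    dsimp only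
    rw [← integral_mul_const]
  simp_rw [hL, hR]
  have h1 : ∫ t₀ in Icc lo hi, ∫ x₀, σ ^ 3 * ∫ q, K ((t₀, x₀), q) ∂μ₂ = σ ^ 3 * ∫ p, ∫ q, K (p, q) ∂μ₂ ∂μ₁ := by
    simp_rw [integral_const_mul]
    congr 1
    have h := integral_prod (μ := volume.restrict (Icc lo hi)) (ν := (volume : Measure T3))
      (fun p : ℝ × T3 => ∫ q, K (p, q) ∂μ₂) (by rw [← hμ₁]; exact hInt.integral_prod_left)
    rw [← hμ₁] at h
    exact h.symm
  have h2 : ∫ s in Icc 0 τ, ∫ x, ∫ p, K (p, (s, x)) ∂μ₁ = ∫ q, ∫ p, K (p, q) ∂μ₁ ∂μ₂ := by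
    have h := integral_prod (μ := volume.restrict (Icc 0 τ)) (ν := (volume : Measure T3))
      (fun q : ℝ × T3 => ∫ p, K (p, q) ∂μ₁) (by rw [← hμ₂]; exact hInt.integral_prod_right)
    rw [← hμ₂] at h
    exact h.symm
  rw [h1, h2, integral_integral_swap hInt]

end Window

/-! ## §3 The windowed field itself -/

section WindowField

open Function

/-- **The windowed field is jointly measurable**: for a bounded jointly measurable `F`,
`(t₀, x₀) ↦ ∫_{s ∈ [0,τ]} bt(s − t₀) ∫_x b_r(x, x₀) F(s, x)` is measurable (`0 < r`). [folklore] -/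
theorem measurable_windowField {r : ℝ} (hr : 0 < r) {F : ℝ → T3 → ℝ} (hF : Measurable (uncurry F)) {C : ℝ}
    (hFb : ∀ s x, |F s x| ≤ C) (τ : ℝ) :
    Measurable fun p : ℝ × T3 => ∫ s in Icc 0 τ, r⁻¹ * max (1 - |s - p.1| / r) 0 * ∫ x, cone r x p.2 * F s x := by
  set K : (ℝ × T3) × (ℝ × T3) → ℝ := fun v =>
    (fun _ : ℝ × T3 => (1 : ℝ)) v.1 * (r⁻¹ * max (1 - |v.2.1 - v.1.1| / r) 0 * cone r v.2.2 v.1.2) * F v.2.1 v.2.2 with hK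
  have hKm : Measurable K := measurable_windowKernel continuous_const r hF
  have hC0 : 0 ≤ C := (abs_nonneg _).trans (hFb 0 0)
  have hKb : ∀ v, ‖K v‖ ≤ r⁻¹ * (3 / (Real.pi * r ^ 3)) * C := by
    intro v
    rw [Real.norm_eq_abs, hK]
    dsimp only
    have ht := ChaosClosesEulerWindowedInvariance.tent_nonneg_le hr (v.2.1 - v.1.1)
    have hc0 := cone_nonneg hr v.2.2 v.1.2
    have hc1 : cone r v.2.2 v.1.2 ≤ 3 / (Real.pi * r ^ 3) :=
      (le_abs_self _).trans (LocalSecondLawLedger.L.abs_cone_le hr v.2.2 v.1.2)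
    rw [one_mul, abs_mul, abs_mul, abs_of_nonneg ht.1, abs_of_nonneg hc0]
    exact mul_le_mul (mul_le_mul ht.2 hc1 hc0 (inv_nonneg.2 hr.le)) (hFb _ _) (abs_nonneg _) (by positivity)
  set μ₂ : Measure (ℝ × T3) := (volume.restrict (Icc 0 τ)).prod volume with hμ₂
  haveI : IsFiniteMeasure ((volume : Measure ℝ).restrict (Icc 0 τ)) :=
    ⟨by rw [Measure.restrict_apply_univ, Real.volume_Icc]; exact ENNReal.ofReal_lt_top⟩
  have hsm : StronglyMeasurable fun p : ℝ × T3 => ∫ q, K (p, q) ∂μ₂ := hKm.stronglyMeasurable.integral_prod_right'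
  have heq : (fun p : ℝ × T3 => ∫ s in Icc 0 τ, r⁻¹ * max (1 - |s - p.1| / r) 0 * ∫ x, cone r x p.2 * F s x) =
      fun p => ∫ q, K (p, q) ∂μ₂ := by
    funext p
    have hInt : Integrable (fun q : ℝ × T3 => K (p, q)) μ₂ :=
      Integrable.of_bound (hKm.comp (measurable_const.prodMk measurable_id)).aestronglyMeasurable _
        (ae_of_all _ fun q => hKb _)
    rw [hμ₂, integral_prod _ hInt]
    refine integral_congr_ae (ae_of_all _ fun s => ?_)
    dsimp only
    rw [← integral_const_mul]
    refine integral_congr_ae (ae_of_all _ fun x => ?_)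
    rw [hK]; ring
  rw [heq]; exact hsm.measurable

/-- **The windowed field is bounded by `C`** when `|F| ≤ C` (tent mass `≤ 1`, unit cone mass; `0 < r < 1/2`).
[folklore] -/
theorem abs_windowField_le {r : ℝ} (hr : 0 < r) (hr2 : r < 1 / 2) {F : ℝ → T3 → ℝ}
    {C : ℝ} (hFb : ∀ s x, |F s x| ≤ C) (τ t₀ : ℝ) (x₀ : T3) :
    |∫ s in Icc 0 τ, r⁻¹ * max (1 - |s - t₀| / r) 0 * ∫ x, cone r x x₀ * F s x| ≤ C := by
  have hC0 : 0 ≤ C := (abs_nonneg _).trans (hFb 0 0)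
  have hinner : ∀ s, |∫ x, cone r x x₀ * F s x| ≤ C := by
    intro s
    have hcont : Continuous fun x => cone r x x₀ := by
      unfold cone
      refine continuous_const.mul ((continuous_const.sub (Continuous.div_const ?_ _)).max continuous_const)
      exact Torus.continuous_norm_reprSym.comp (continuous_id.sub continuous_const)
    calc |∫ x, cone r x x₀ * F s x| ≤ ∫ x, |cone r x x₀ * F s x| := abs_integral_le_integral_abs
      _ ≤ ∫ x, cone r x x₀ * C := by
          refine integral_mono_of_nonneg (ae_of_all _ fun x => abs_nonneg _)
            ((integrable_of_continuous_T3 hcont).mul_const C) (ae_of_all _ fun x => ?_)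
          dsimp only
          rw [abs_mul, abs_of_nonneg (cone_nonneg hr _ _)]
          exact mul_le_mul_of_nonneg_left (hFb s x) (cone_nonneg hr _ _)
      _ = C := by
          rw [integral_mul_const]
          rw [integral_cone_eq_one' hr hr2 x₀, one_mul]
  calc |∫ s in Icc 0 τ, r⁻¹ * max (1 - |s - t₀| / r) 0 * ∫ x, cone r x x₀ * F s x|
      ≤ ∫ s in Icc 0 τ, |r⁻¹ * max (1 - |s - t₀| / r) 0 * ∫ x, cone r x x₀ * F s x| := abs_integral_le_integral_abs
    _ ≤ ∫ s in Icc 0 τ, r⁻¹ * max (1 - |t₀ - s| / r) 0 * C := by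
        refine integral_mono_of_nonneg (ae_of_all _ fun s => abs_nonneg _)
          ((integrable_tent_sub hr t₀).integrableOn.mul_const C) (ae_of_all _ fun s => ?_)
        dsimp only
        have ht := ChaosClosesEulerWindowedInvariance.tent_nonneg_le hr (s - t₀)
        rw [abs_mul, abs_of_nonneg ht.1, abs_sub_comm s t₀]
        rw [abs_sub_comm s t₀] at ht
        exact mul_le_mul_of_nonneg_left (hinner s) ht.1
    _ ≤ 1 * C := by
        rw [integral_mul_const]
        exact mul_le_mul_of_nonneg_right (setIntegral_tent_le_one hr t₀ (Icc 0 τ)) hC0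
    _ = C := one_mul C

end WindowField

/-! ## §4 Registered sub-goal -/

/-- **Registered sub-goal `stub_pressureValueE` (helper E of `stub_pressureValueOfEnskog`): the tent × cone
windowed field of a bounded field is bounded by the same constant.** [folklore] -/
theorem stub_pressureValueE : ∀ {r : ℝ}, 0 < r → r < 1 / 2 → ∀ {F : ℝ → T3 → ℝ} {C : ℝ}, (∀ s x, |F s x| ≤ C) → ∀ (τ t₀ : ℝ) (x₀ : T3), |∫ s in Set.Icc 0 τ, r⁻¹ * max (1 - |s - t₀| / r) 0 * ∫ x, cone r x x₀ * F s x| ≤ C :=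
  fun hr hr2 _ _ hFb τ t₀ x₀ => abs_windowField_le hr hr2 hFb τ t₀ x₀

end Summit.AtomisticToContinuum.HydrodynamicLimit.Theorems.ChaosClosesEulerPressureValue

end
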